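import Mathlib
import HarnessLib
import Summits.NavierStokesRegularity.NavierStokesRegularity.Theorems.UnthreadedDoorCellFluxDefs
import Summits.NavierStokesRegularity.NavierStokesRegularity.Theorems.UnthreadedDoorCellFluxGlue
import Summits.NavierStokesRegularity.NavierStokesRegularity.Theorems.UnthreadedDoorCellFluxZDefs
import Summits.NavierStokesRegularity.NavierStokesRegularity.Theorems.UnthreadedDoorCellFluxForwardVanishing
import Summits.NavierStokesRegularity.NavierStokesRegularity.Theorems.UnthreadedDoorCellFluxKNSSTransfer
import Summits.NavierStokesRegularity.NavierStokesRegularity.Theorems.UnthreadedDoorCellFluxZonalKinematic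
import Summits.NavierStokesRegularity.NavierStokesRegularity.Theorems.UnthreadedDoorCellFluxAxisFrozen

/-!
# Route `UnthreadedDoor`, crux `PoloidalLiouville` (stmt-NavierStokesRegularity-1222), WALL W1 — **Z `ZonalUnthreadedVorticityVanishes` PROVED**
# (cell-flux Z skeleton `Cruxes/PoloidalLiouville/CellFluxZSkeleton.lean` v1.1 c6ae0be7f8d8, custodian ns-idea-14 g6; critic ns-wall-crit-1 V22)

The four registered stubs of the Z skeleton are tree theorems — Z-1a `zonalKinematic` (p696980), Z-1b `axisFrozen`, Z-2 `forwardVanishing` (p696036),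
Z-3 `knssTransfer` (p696933) — and the kernel-checked composition `zonalUnthreadedVorticityVanishes_of` (ZDefs twin, p696007) turns them into

* `zonalUnthreadedVorticityVanishes : CellFlux.ZonalUnthreadedVorticityVanishes` — an UNTHREADED (`ω = ∇T × (x − x₀)`) bounded ancient mild solution
  (duality class, `ν = 1`, a.e.-measurable slices, smooth on the slab) whose vorticity is at every time orthogonal to some constant direction is
  IRROTATIONAL («KNSS Thm 5.2 in a moving frame»: symmetry bootstrap to exact axisymmetry without swirl about a frozen axis on an ancient interval,
  then the PROVED `Literature.Analysis.FluidPDE.knss_axisymmetric_no_swirl_holds`);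
* `zonalTypeIScalarLiouville : CellFlux.ZonalTypeIScalarLiouville` — the zonal Type-I scalar Liouville rung Σ-Z (kernel glue `zonal_of_vanishes`, p693177);
* `unthreadedAnalyticOrIrrotational_of_gaugeRigidity : UnthreadedGaugeRigidity → UnthreadedAnalyticOrIrrotational` — the branch statement, now
  conditional on Σ-5a only (kernel glue `analyticOrIrrotational_of`).

BOOKING (critic V22-P6 (a), verbatim): Z is «KNSS Thm 5.2 in a moving frame», information-grade for W1 (movement 0); it turns `ZonalTypeIScalarLiouville`
into a theorem rung; with Σ-5a it gives `UnthreadedAnalyticOrIrrotational` (conditional until Σ-5a lands).  NS regularity is NOT proved; 1222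
`PoloidalLiouville`, `PoloidalLiouvilleTypeI`, the wall stub `stub_scalarLiouville`, Σ-5a and W1 are OPEN.  `--supports stmt-NavierStokesRegularity-1222 --as helper`.
-/

noncomputable section

-- the summit and its single sub-problem share the name (CONVENTIONS §1)
set_option linter.dupNamespace false

namespace Summit.NavierStokesRegularity.NavierStokesRegularity.Theorems.PoloidalLiouville.CellFlux

/-- **Z `ZonalUnthreadedVorticityVanishes` (cell-flux v1.2; the landed Defs-twin decl of `UnthreadedDoorCellFluxDefs`, p692073) — PROVED**: composition
`zonalUnthreadedVorticityVanishes_of` of the four landed stubs Z-1a `zonalKinematic`, Z-1b `axisFrozen`, Z-2 `forwardVanishing`, Z-3 `knssTransfer`.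
[cite: KochNadirashviliSereginSverak2009, Thm 5.2 (arXiv:0709.3599 pp. 9–10)] -/
theorem zonalUnthreadedVorticityVanishes : ZonalUnthreadedVorticityVanishes :=
  zonalUnthreadedVorticityVanishes_of zonalKinematic axisFrozen forwardVanishing knssTransfer

/-- **Σ-Z `ZonalTypeIScalarLiouville` — the zonal Type-I scalar Liouville rung, PROVED** (Z ∘ kernel glue `zonal_of_vanishes`). [folklore] -/
theorem zonalTypeIScalarLiouville : ZonalTypeIScalarLiouville :=
  zonal_of_vanishes zonalUnthreadedVorticityVanishes

/-- **`UnthreadedAnalyticOrIrrotational` from Σ-5a alone** (Z is now a theorem; kernel glue `analyticOrIrrotational_of`).  CONDITIONAL on the OPEN Σ-5a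
`UnthreadedGaugeRigidity`, carried as a hypothesis. [folklore] -/
theorem unthreadedAnalyticOrIrrotational_of_gaugeRigidity (h5a : UnthreadedGaugeRigidity) : UnthreadedAnalyticOrIrrotational :=
  analyticOrIrrotational_of h5a zonalUnthreadedVorticityVanishes

end Summit.NavierStokesRegularity.NavierStokesRegularity.Theorems.PoloidalLiouville.CellFlux

end
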